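import Summits.KontsevichZagierPeriods.KontsevichZagierPeriods.Theorems.IsogenyCertificatesAlgebraicModuliRealPeriodCellPeriodRep
import Summits.KontsevichZagierPeriods.KontsevichZagierPeriods.Theorems.IsogenyCertificatesAlgebraicModuliRealPeriodCellTransferCellsBasic
import Summits.KontsevichZagierPeriods.KontsevichZagierPeriods.Theorems.IsogenyCertificatesAlgebraicModuliRealPeriodCellTransferCellMonotone
import Summits.KontsevichZagierPeriods.KontsevichZagierPeriods.Theorems.IsogenyCertificatesAlgebraicModuliRealPeriodCellTransferCellEnds
import Summits.KontsevichZagierPeriods.KontsevichZagierPeriods.Theorems.IsogenyCertificatesAlgebraicModuliRealPeriodCellTransferIntervalImage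
import Summits.KontsevichZagierPeriods.KontsevichZagierPeriods.Theorems.IsogenyCertificatesAlgebraicModuliRealPeriodCellTransferCubicComponents
import Summits.KontsevichZagierPeriods.KontsevichZagierPeriods.Theorems.IsogenyCertificatesAlgebraicModuliRealPeriodCellTransferDupDatum

/-!
# `AlgebraicModuliRealPeriodCell` (stmt-KontsevichZagierPeriods-18265), line `Sketch` — stub T
(`stub_algXMapTransfer`): every cell is mapped injectively onto a whole component of `{P' > 0}`

Port of the ℚ-line's `Theorems/IsogenyCertificatesXMapPeriodTransferCellImage.lean` to real(-algebraic)
data: assembled from the ported cell stubs (`stub_cellMonotone`, `stub_cellEnds`, `stub_intervalImage`,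
`stub_cubicComponents`, `stub_dupDatum`). The image of every cell of a COPRIME datum is the unbounded
component `U'` of `{P' > 0}`, or its egg `E'` (the latter lying strictly below a root of `P'`), and the
x-map is injective on the cell; every cell of the duplication datum lands on the unbounded component.
Pure real analysis: no algebraicity hypothesis is needed in this file except where representations are
built (`value_rep`, `unbounded_period_pos` need none either).

References: Kontsevich–Zagier 2001 §1.2; Silverman AEC (2009) III.4–III.6; Cassels LEC (1991) §15;
Basu–Pollack–Roy (2006) Thm. 5.22.
-/

noncomputable section

open Set Filter MeasureTheory Polynomial Topology
open Literature.NumberTheory.Transcendental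
open Literature.ModelTheory.ExponentialFields (IsSemialgebraic)

namespace Summit.KontsevichZagierPeriods.IsogenyCertificates.AlgRealPeriodCell.TransferCellImage

open TransferCellsBasic TransferCellMonotone TransferCellEnds TransferIntervalImage TransferCubicComponents
  TransferDupDatum

/-! ### Every cell is mapped injectively onto a whole component of `{P' > 0}` -/

/-- The image of every cell of a COPRIME real datum is the unbounded component `U'` of `{P' > 0}`, or its
egg `E'`, the latter lying strictly below a root of `P'`; and the x-map is injective on the cell
(assembled from `stub_cellMonotone`, `stub_cellEnds`, `stub_intervalImage`, `stub_cubicComponents`).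
[folklore] -/
theorem cellImageComponent : ∀ (α β α' β' : ℝ) (f g : Polynomial ℝ) (c : ℝ), 4 * α' ^ 3 + 27 * β' ^ 2 ≠ 0 → Polynomial.derivative f * g - f * Polynomial.derivative g ≠ 0 → Polynomial.C (c ^ 2) * g * (f ^ 3 + Polynomial.C α' * f * g ^ 2 + Polynomial.C β' * g ^ 3) = (Polynomial.X ^ 3 + Polynomial.C α * Polynomial.X + Polynomial.C β) * (Polynomial.derivative f * g - f * Polynomial.derivative g) ^ 2 → IsCoprime f g → ∀ (R W : ℝ → ℝ) (L : Set ℝ), R = (fun y => f.eval y / g.eval y) → W = (fun y => (Polynomial.derivative f * g - f * Polynomial.derivative g).eval y) → L = {y : ℝ | 0 < y ^ 3 + α * y + β ∧ W y ≠ 0} → ∀ (U' E' : Set ℝ), U' = connectedComponentIn {y : ℝ | 0 < y ^ 3 + α' * y + β'} (1 + |α'| + |β'|) → E' = {y : ℝ | 0 < y ^ 3 + α' * y + β'} \ U' → ∀ x₀ ∈ L, Set.InjOn R (connectedComponentIn L x₀) ∧ (R '' connectedComponentIn L x₀ = U' ∨ (R '' connectedComponentIn L x₀ = E' ∧ ∃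 v : ℝ, v ^ 3 + α' * v + β' = 0 ∧ ∀ y ∈ R '' connectedComponentIn L x₀, y < v)) := by
  intro α β α' β' f g c hΔ' hW hI hcop R W L hR hWd hL' U' E' hU' hE' x₀ hx₀
  subst hU' hE'
  obtain ⟨hloc, hmono, p, hpx, hpW, hshape⟩ :=
    stub_cellMonotone α β α' β' f g c hW hI R W L hR hWd hL' x₀ hx₀
  obtain ⟨hends, hinf⟩ := stub_cellEnds α β α' β' f g c hW hI hcop R W hR hWd
  have hx₀C : x₀ ∈ connectedComponentIn L x₀ := mem_connectedComponentIn hx₀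
  have hinj : InjOn R (connectedComponentIn L x₀) := by
    rcases hmono with h | h
    · exact h.injOn
    · exact h.injOn
  refine ⟨hinj, ?_⟩
  have hcont : ContinuousOn R (connectedComponentIn L x₀) := fun x hx =>
    (hloc x hx).2.2.continuousAt.continuousWithinAt
  have hsub : R '' connectedComponentIn L x₀ ⊆ {y : ℝ | 0 < y ^ 3 + α' * y + β'} := by
    rintro _ ⟨x, hx, rfl⟩
    exact (hloc x hx).2.1
  have hCshape : connectedComponentIn L x₀ = Ioi p ∨
      ∃ q : ℝ, p < q ∧ connectedComponentIn L x₀ = Ioo p q := by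
    rcases hshape with h | ⟨q, hxq, _, h⟩
    · exact Or.inl h
    · exact Or.inr ⟨q, hpx.trans hxq, h⟩
  -- one-sided limits from the punctured ones
  have mono_ne : ∀ {p : ℝ} {s : Set ℝ}, s ⊆ {p}ᶜ → 𝓝[s] p ≤ 𝓝[≠] p := fun h => nhdsWithin_mono _ h
  have hleft : (∃ ℓ : ℝ, ℓ ^ 3 + α' * ℓ + β' = 0 ∧ Tendsto R (𝓝[>] p) (𝓝 ℓ)) ∨
      Tendsto (fun x => |R x|) (𝓝[>] p) atTop := by
    rcases hends p hpW with ⟨ℓ, hℓ, ht⟩ | ht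
    · exact Or.inl ⟨ℓ, hℓ, ht.mono_left (mono_ne fun x hx => ne_of_gt hx)⟩
    · exact Or.inr (ht.mono_left (mono_ne fun x hx => ne_of_gt hx))
  -- the right end `q` of a bounded cell satisfies `P(q)·W(q) = 0`
  have hqW : ∀ q : ℝ, connectedComponentIn L x₀ = Ioo p q → (q ^ 3 + α * q + β) * W q = 0 := by
    intro q hq
    have hx₀q : p < x₀ ∧ x₀ < q := by rw [hq] at hx₀C; exact hx₀C
    rcases hshape with h | ⟨q', hxq', hq'W, h⟩
    · exfalso
      have hmem : q + 1 ∈ Ioi p := by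
        show p < q + 1
        linarith [hx₀q.1, hx₀q.2]
      rw [← h, hq] at hmem
      linarith [hmem.2]
    · have e1 : Ioo p q = Ioo p q' := hq.symm.trans h
      have h1 := (Set.Ioo_subset_Ioo_iff (hx₀q.1.trans hx₀q.2)).1 e1.le
      have h2 := (Set.Ioo_subset_Ioo_iff (hpx.trans hxq')).1 e1.ge
      have hqq : q = q' := le_antisymm h1.2 h2.2
      rw [hqq]; exact hq'W
  have hright : ∀ q : ℝ, connectedComponentIn L x₀ = Ioo p q →
      (∃ ℓ : ℝ, ℓ ^ 3 + α' * ℓ + β' = 0 ∧ Tendsto R (𝓝[<] q) (𝓝 ℓ)) ∨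
        Tendsto (fun x => |R x|) (𝓝[<] q) atTop := by
    intro q hq
    rcases hends q (hqW q hq) with ⟨ℓ, hℓ, ht⟩ | ht
    · exact Or.inl ⟨ℓ, hℓ, ht.mono_left (mono_ne fun x hx => ne_of_lt hx)⟩
    · exact Or.inr (ht.mono_left (mono_ne fun x hx => ne_of_lt hx))
  have hinf' : connectedComponentIn L x₀ = Ioi p →
      (∃ ℓ : ℝ, ℓ ^ 3 + α' * ℓ + β' = 0 ∧ Tendsto R atTop (𝓝 ℓ)) ∨
        Tendsto (fun x => |R x|) atTop atTop := fun _ => hinf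
  obtain ⟨u, hu, himg⟩ := stub_intervalImage α' β' R (connectedComponentIn L x₀)
    p hCshape hcont hmono hsub hleft hright hinf'
  obtain ⟨hK1, hK2⟩ := stub_cubicComponents α' β' hΔ' _ rfl u hu
  rcases himg with h | ⟨v, hv, huv, h⟩
  · left
    rw [h]
    exact hK1 (h ▸ hsub)
  · right
    refine ⟨?_, v, hv, fun y hy => ?_⟩
    · rw [h]; exact hK2 v hv huv (h ▸ hsub)
    · rw [h] at hy; exact hy.2

/-- A cell lies in `{P > 0}`. [folklore] -/
theorem cell_subset_pos (α β : ℝ) (f g : ℝ[X]) (x₀ : ℝ) :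
    connectedComponentIn {y : ℝ | 0 < y ^ 3 + α * y + β ∧
      (derivative f * g - f * derivative g).eval y ≠ 0} x₀ ⊆ {y : ℝ | 0 < y ^ 3 + α * y + β} :=
  (connectedComponentIn_subset _ _).trans fun _ h => h.1

/-- A cell meeting the unbounded component lies in it (saturation). [folklore] -/
theorem cell_subset_unbounded (α β : ℝ) (f g : ℝ[X]) {x₀ : ℝ}
    (hx₀ : x₀ ∈ {y : ℝ | 0 < y ^ 3 + α * y + β ∧ (derivative f * g - f * derivative g).eval y ≠ 0})
    (hK : x₀ ∈ connectedComponentIn {y : ℝ | 0 < y ^ 3 + α * y + β} (1 + |α| + |β|)) :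
    connectedComponentIn {y : ℝ | 0 < y ^ 3 + α * y + β ∧
      (derivative f * g - f * derivative g).eval y ≠ 0} x₀ ⊆
      connectedComponentIn {y : ℝ | 0 < y ^ 3 + α * y + β} (1 + |α| + |β|) := by
  have h1 := (isPreconnected_connectedComponentIn).subset_connectedComponentIn
      (mem_connectedComponentIn hx₀) (cell_subset_pos α β f g x₀)
  rw [connectedComponentIn_eq hK]
  exact h1

/-- A cell meeting the egg lies in it (saturation). [folklore] -/
theorem cell_subset_egg (α β : ℝ) (f g : ℝ[X]) {x₀ : ℝ}
    (hx₀ : x₀ ∈ {y : ℝ | 0 < y ^ 3 + α * y + β ∧ (derivative f * g - f * derivative g).eval y ≠ 0})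
    (hK : x₀ ∈ {y : ℝ | 0 < y ^ 3 + α * y + β} \
      connectedComponentIn {y : ℝ | 0 < y ^ 3 + α * y + β} (1 + |α| + |β|)) :
    connectedComponentIn {y : ℝ | 0 < y ^ 3 + α * y + β ∧
      (derivative f * g - f * derivative g).eval y ≠ 0} x₀ ⊆
      {y : ℝ | 0 < y ^ 3 + α * y + β} \
        connectedComponentIn {y : ℝ | 0 < y ^ 3 + α * y + β} (1 + |α| + |β|) := by
  have h1 := (isPreconnected_connectedComponentIn).subset_connectedComponentIn
      (mem_connectedComponentIn hx₀) (cell_subset_pos α β f g x₀)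
  refine h1.trans fun z hz => ⟨connectedComponentIn_subset _ _ hz, fun hzU => hK.2 ?_⟩
  have e1 : connectedComponentIn {y : ℝ | 0 < y ^ 3 + α * y + β} x₀ =
      connectedComponentIn {y : ℝ | 0 < y ^ 3 + α * y + β} z := connectedComponentIn_eq hz
  rw [connectedComponentIn_eq hzU, ← e1]
  exact mem_connectedComponentIn hK.1

/-! ### The duplication datum on the target curve -/

/-- Every cell of the duplication datum of a nonsingular real cubic is mapped injectively onto the
unbounded component. [folklore] -/
theorem dup_cell_image (α β : ℝ) (hΔ : 4 * α ^ 3 + 27 * β ^ 2 ≠ 0) (f₂ g₂ : ℝ[X])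
    (hf₂ : f₂ = X ^ 4 - C (2 * α) * X ^ 2 - C (8 * β) * X + C (α ^ 2))
    (hg₂ : g₂ = C 4 * (X ^ 3 + C α * X + C β)) {x₀ : ℝ}
    (hx₀ : x₀ ∈ {y : ℝ | 0 < y ^ 3 + α * y + β ∧ (derivative f₂ * g₂ - f₂ * derivative g₂).eval y ≠ 0}) :
    InjOn (fun y => f₂.eval y / g₂.eval y) (connectedComponentIn {y : ℝ | 0 < y ^ 3 + α * y + β ∧
      (derivative f₂ * g₂ - f₂ * derivative g₂).eval y ≠ 0} x₀) ∧
    (fun y => f₂.eval y / g₂.eval y) '' connectedComponentIn {y : ℝ | 0 < y ^ 3 + α * y + β ∧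
        (derivative f₂ * g₂ - f₂ * derivative g₂).eval y ≠ 0} x₀ =
      connectedComponentIn {y : ℝ | 0 < y ^ 3 + α * y + β} (1 + |α| + |β|) := by
  obtain ⟨hW₂, hI₂, hcop₂, hge⟩ := stub_dupDatum α β f₂ g₂ hf₂ hg₂
  obtain ⟨hinj, himg⟩ := cellImageComponent α β α β f₂ g₂ 2 hΔ hW₂ hI₂ (hcop₂ hΔ) _ _ _ rfl rfl rfl
    _ _ rfl rfl x₀ hx₀
  refine ⟨hinj, ?_⟩
  rcases himg with h | ⟨-, v, hv, hlt⟩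
  · exact h
  · exfalso
    have h1 := hlt _ (mem_image_of_mem _ (mem_connectedComponentIn hx₀))
    exact absurd h1 (not_lt.2 (hge v x₀ hv hx₀.1))

/-! ### Values of representations `[D, s/√P]` -/

/-- Value of a representation `[D, s/√P]`. [folklore] -/
theorem value_rep {α β s : ℝ} {D : Set (Fin 1 → ℝ)} (ρ : KZ.IntegralRep 1) (hd : ρ.domain = D)
    (he : EqOn ρ.integrand (fun x => s / Real.sqrt (x 0 ^ 3 + α * x 0 + β)) ρ.domain) :
    ρ.value = s * ∫ x in D, 1 / Real.sqrt (x 0 ^ 3 + α * x 0 + β) := by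
  rw [KZ.IntegralRep.value, setIntegral_congr_fun (KZ.IntegralRep.measurableSet_domain_holds ρ) he, hd,
    ← integral_const_mul]
  congr 1; ext x; ring

/-- The unbounded-component period is positive. [folklore] -/
theorem unbounded_period_pos (α β : ℝ)
    (hint : IntegrableOn (fun x : Fin 1 → ℝ => 1 / Real.sqrt (x 0 ^ 3 + α * x 0 + β))
      {x : Fin 1 → ℝ | 0 < x 0 ^ 3 + α * x 0 + β}) :
    0 < ∫ x in {x : Fin 1 → ℝ | x 0 ∈ connectedComponentIn {y : ℝ | 0 < y ^ 3 + α * y + β}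
      (1 + |α| + |β|)}, 1 / Real.sqrt (x 0 ^ 3 + α * x 0 + β) := by
  set U := connectedComponentIn {y : ℝ | 0 < y ^ 3 + α * y + β} (1 + |α| + |β|) with hU
  have hUopen : IsOpen U := (isOpen_lt continuous_const (by fun_prop)).connectedComponentIn
  have hopen : IsOpen {x : Fin 1 → ℝ | x 0 ∈ U} := hUopen.preimage (continuous_apply 0)
  have hmeas : MeasurableSet {x : Fin 1 → ℝ | x 0 ∈ U} := hopen.measurableSet
  have hUS : U ⊆ {y : ℝ | 0 < y ^ 3 + α * y + β} := connectedComponentIn_subset _ _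
  have hsubS : {x : Fin 1 → ℝ | x 0 ∈ U} ⊆ {x : Fin 1 → ℝ | 0 < x 0 ^ 3 + α * x 0 + β} :=
    fun x hx => hUS hx
  have hM : (1 + |α| + |β|) ∈ U := mem_connectedComponentIn (cubic_pos_of_large_le α β le_rfl)
  rw [setIntegral_pos_iff_support_of_nonneg_ae ?_ (hint.mono_set hsubS)]
  · have hsub : {x : Fin 1 → ℝ | x 0 ∈ U} ⊆
        Function.support (fun x : Fin 1 → ℝ => 1 / Real.sqrt (x 0 ^ 3 + α * x 0 + β)) ∩
          {x : Fin 1 → ℝ | x 0 ∈ U} := by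
      intro x hx
      refine ⟨?_, hx⟩
      simp only [Function.mem_support, ne_eq, one_div, inv_eq_zero]
      exact (Real.sqrt_pos.mpr (hUS hx)).ne'
    refine lt_of_lt_of_le ?_ (measure_mono hsub)
    exact hopen.measure_pos volume ⟨fun _ => 1 + |α| + |β|, hM⟩
  · filter_upwards [ae_restrict_mem hmeas] with x hx
    exact div_nonneg zero_le_one (Real.sqrt_nonneg _)

end Summit.KontsevichZagierPeriods.IsogenyCertificates.AlgRealPeriodCell.TransferCellImage

end
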